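import Summits.QuantumFields.BalabanUV.Beta.FP.LatticeConvolutionBounds
import Literature.MathematicalPhysics.QuantumFieldTheory.Balaban1983to89.Beta.OneStepKernelFamily

/-!
# `BalabanUV.Beta.FP.WardZerothMomentSextic` — road «FP» for binder row D1, organisation γ, the (K0)-SOCKET OF THE γ-END AT THE ROAD's DECAY: the Ward ∕ (T0) letter
# `HasSum (K c e) 0` of `HorizontalRemainderPerfect.*` ∕ `RemainderLedger.*` ∕ `HorizontalTailAssemblyCov.hasSum_truncatedTransport_cov` FROM THE PRINTED WARD IDENTITY (5.9)
# in the kernel convention `WardTransversal (flipK K)` AND SEXTIC DECAY (K6) ONLY — the tree's `PolarizationSign.tsum_eq_zero_of_ward` asks `MomentSummable P 3`, which a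
# kernel with the sextic decay of a one-loop vacuum polarization on `ℤ⁴` does NOT have (`Σ_z |z|³·|z|⁻⁶ = ∞`); its proof uses first moments only, re-cut here at `MomentSummable P 1`

HONEST DEPENDENCY (page 1, mandatory): continuum YM on T⁴ ⇐ BetaPertH ∧ nine spine estimates (0/9 proved); BetaPertH ⇐ (D1) ∧ (D4) ∧
CAP+tail; G-an2-4 gates asym, D1 and NE2/3/4.  HONEST FRAMING (cell contract, verbatim): «discharging `BetaPertH` makes Bałaban's UV
stability UNCONDITIONAL — a real constructive-QFT result; it is NOT the continuum limit and NOT the Clay problem.»  THIS MODULE is elementary [folklore]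
lattice summation on `ℤ⁴`: summation by parts against the tree's [cite]-tagged PREDICATE `PolarizationSign.WardTransversal` ((5.9) p. 293 of [Balaban1987RG1], a
HYPOTHESIS here, asserted of nothing) via the tree's `PolarizationSign.ward_pairing`, and the summability of `(‖z‖∞+1)⁻⁵` on `ℤ⁴` (`LatticeConvolutionBounds.summable_inv_pow`).
No `def`, no `def … : Prop`, nothing cited, 0 sorry; 0 estimates of Bałaban's objects; 0∕4 row-D1 binders; NOT the Ward identity of `PiBF` itself (sub-row H2-ASM-5a,
`PerfectPolarizationWard.wardTransversal_flip_PiBF`), NOT hbook, NOT hasym, NOT D1, NOT BetaPertH, NOT continuum, NOT Clay.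

ABSOLUTE RULE (cell charter, verbatim): «No internally-minted statement may enter as a cited fact. Every hypothesis is either kernel-proved in this
package or a verbatim quotation of a PUBLISHED theorem with page reference. The manuscript(s) under audit are NOT citable for their own disputed
steps — they are the thing under adjudication; programme-internal (2001/route/tribunal) claims are never citable.»

WHY (NOTE N-d1leaf01g10-2).  The γ-END of record consumes the transported kernel `K` through (K6) sextic decay, (Kcov) (R-FP-32) and **(K0) `∀ c e, HasSum (K c e) 0`**.  On the
road `K = PiBF …`, whose Ward identity `WardTransversal (flipK (PiBF …))` is H2-ASM-5a (`PerfectPolarizationWard`, which says «NOT (K0) itself (needs `MomentSummable` from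
(K6))»).  The only tree passage from the Ward identity to vanishing zeroth moments, `PolarizationSign.tsum_eq_zero_of_ward` (and `ScalewiseVectorSeam.hasSum_zero_of_ward(_flip)`,
`StepLawWard.wardDiag_of_ward_flip` via `AbsMoment₂`), is typed at CUBIC (resp. quadratic) moment summability — true for the wall's exponentially decaying one-step kernels
((5.10)), FALSE for a kernel that decays exactly like `(‖z‖∞+1)⁻⁶` in four dimensions (cubic: `Σ r³·r³·r⁻⁶ = Σ 1`; quadratic: `Σ r³·r²·r⁻⁶ = Σ r⁻¹`; the off-diagonal
germ of `PiBF` is `kappaBal N·transverseUnit ≠ 0`, so the decay is not better).  The Ward route itself needs only FIRST moments (the linear test weight `z_α` and its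
unit shift): `MomentSummable P 1`, which sextic decay DOES give (`Σ r³·r·r⁻⁶ = Σ r⁻² < ∞`).  This file is that re-cut — the (K0) socket supplier at the road's decay.

CONTENT (all [folklore]):
* §1 `size_le_five_mul_supNorm_succ` (`size z ≤ 5·(‖z‖∞+1)` on `ℤ⁴`), **`momentSummable_one_of_sextic`** ((K6) ⟹ `MomentSummable K 1`), `momentSummable_one_flipK`.
* §2 **`tsum_eq_zero_of_ward_one`** (any `d`: `MomentSummable P 1 ∧ WardTransversal P ⟹ Σ' z, P α ν z = 0` — the tree proof of `tsum_eq_zero_of_ward` at exponent 1),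
  `hasSum_zero_of_ward_one`.
* §3 THE SOCKET: **`hasSum_zero_of_ward_sextic`** (`WardTransversal K` + (K6) ⟹ `∀ c e, HasSum (K c e) 0`) and **`hasSum_zero_of_ward_flip_sextic`**
  (`WardTransversal (flipK K)` + (K6) ⟹ `∀ c e, HasSum (K c e) 0` — the kernel-convention form (RULING (R21)) in which H2-ASM-5a delivers the Ward identity of `PiBF`).
Provenance: D1 formalisation swarm, unit b2b-balaban-beta-d1-formalise-leaf-01 gen 10 (prover-b2b-balaban-beta-d1-formalise-leaf-01-g10-0), 2026-08-21; «not in print; our bookkeeping».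
-/

noncomputable section

namespace Summit.QuantumFields.BalabanUV.Beta.FP.WardZerothMomentSextic

open Finset
open Literature.MathematicalPhysics.QuantumFieldTheory.Balaban1983to89
open Literature.MathematicalPhysics.QuantumFieldTheory.Balaban1983to89.Beta
open Literature.MathematicalPhysics.QuantumFieldTheory.Balaban1983to89.B6BondElimination (unitVec unitVec_apply)
open PolarizationSign (WardTransversal MomentSummable size abs_apply_le_size size_add_unitVec_le one_le_size ward_pairing)
open OneStepKernelFamily (flipK flipK_apply hasSum_flipK_iff)
open DressedMomentNormalisation (EKer)
open DyadicShell (Pt supNorm natAbs_le_supNorm)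
open GradedBubbles (supNorm_neg)
open Summit.QuantumFields.BalabanUV.Beta.FP.LatticeConvolutionBounds (summable_inv_pow)

/-! ## §1 Sextic decay gives first-moment summability -/

/-- [folklore] On `ℤ⁴`: `size z = 1 + Σ_i |z_i| ≤ 5·(‖z‖∞ + 1)`. -/
theorem size_le_five_mul_supNorm_succ (z : Pt) : size z ≤ 5 * ((supNorm z : ℝ) + 1) := by
  unfold PolarizationSign.size
  have h : ∀ i : Fin 4, |(z i : ℝ)| ≤ (supNorm z : ℝ) := by
    intro i
    have h1 : (z i).natAbs ≤ supNorm z := natAbs_le_supNorm z i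
    have h2 : (|z i| : ℤ) ≤ (supNorm z : ℤ) := by rw [← Int.natCast_natAbs]; exact_mod_cast h1
    have h3 : ((|z i| : ℤ) : ℝ) ≤ ((supNorm z : ℤ) : ℝ) := by exact_mod_cast h2
    simpa [Int.cast_abs] using h3
  have hs : ∑ i : Fin 4, |(z i : ℝ)| ≤ ∑ _i : Fin 4, (supNorm z : ℝ) := Finset.sum_le_sum fun i _ => h i
  rw [Finset.sum_const, Finset.card_univ, Fintype.card_fin, nsmul_eq_mul] at hs
  have h0 : (0 : ℝ) ≤ supNorm z := Nat.cast_nonneg _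
  push_cast at hs
  linarith

/-- **[folklore] (K6) ⟹ `MomentSummable K 1`**: a kernel on `ℤ⁴` with `|K c e t| ≤ C∕(‖t‖∞+1)⁶` has absolutely summable FIRST moments
(`|K|·size ≤ 5C∕(‖t‖∞+1)⁵`, summable by `LatticeConvolutionBounds.summable_inv_pow`).  (Cubic moments — `PolarizationSign.tsum_eq_zero_of_ward`'s hypothesis — are NOT
summable at this decay.) -/
theorem momentSummable_one_of_sextic {K : EKer 4} {C : ℝ} (hK : ∀ c e (t : Pt), |K c e t| ≤ C / ((supNorm t : ℝ) + 1) ^ 6) :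
    MomentSummable K 1 := by
  intro μ ν
  have hC : 0 ≤ C := by
    have h := hK μ ν 0
    have hp : (0 : ℝ) < ((supNorm (0 : Pt) : ℝ) + 1) ^ 6 := by positivity
    rcases div_nonneg_iff.mp ((abs_nonneg _).trans h) with h1 | h1
    · exact h1.1
    · exact absurd h1.2 (not_le.mpr hp)
  refine Summable.of_nonneg_of_le (fun z => mul_nonneg (abs_nonneg _) (pow_nonneg (le_trans zero_le_one (one_le_size z)) _))
    (fun z => ?_) ((summable_inv_pow (t := 5) le_rfl).mul_left (5 * C))
  rw [pow_one]
  have hs : (0 : ℝ) < (supNorm z : ℝ) + 1 := by positivity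
  calc |K μ ν z| * size z ≤ (C / ((supNorm z : ℝ) + 1) ^ 6) * (5 * ((supNorm z : ℝ) + 1)) :=
        mul_le_mul (hK μ ν z) (size_le_five_mul_supNorm_succ z) (le_trans zero_le_one (one_le_size z)) (by positivity)
    _ = 5 * C * (1 / ((supNorm z : ℝ) + 1) ^ 5) := by
        field_simp

/-- [folklore] (K6) is flip-invariant, hence so is the conclusion: `MomentSummable (flipK K) 1`. -/
theorem momentSummable_one_flipK {K : EKer 4} {C : ℝ} (hK : ∀ c e (t : Pt), |K c e t| ≤ C / ((supNorm t : ℝ) + 1) ^ 6) :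
    MomentSummable (flipK K) 1 :=
  momentSummable_one_of_sextic (C := C) fun c e t => by rw [flipK_apply, ← supNorm_neg t]; exact hK c e (-t)

/-! ## §2 The Ward route to vanishing zeroth moments at first-moment summability (any dimension) -/

section Ward

variable {d : ℕ}

/-- **[folklore] ZEROTH MOMENTS VANISH FROM (5.9) AT FIRST-MOMENT SUMMABILITY**: `MomentSummable P 1` and `WardTransversal P` give `Σ' z, P α ν z = 0` for all `α ν`
(the Ward identity tested against the linear weight `z ↦ z_α`; the proof of `PolarizationSign.tsum_eq_zero_of_ward` verbatim with the exponent `3` replaced by `1`,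
which is all it uses). -/
theorem tsum_eq_zero_of_ward_one {P : B12Beta.Kernel d} (hP : MomentSummable P 1) (hT : WardTransversal P)
    (α ν : Fin d) : ∑' z, P α ν z = 0 := by
  have h0 : ∀ μ, Summable fun z => P μ ν z * (z α : ℝ) := fun μ =>
    hP.summable_mul μ ν 1 fun z => by
      rw [one_mul, pow_one]; exact abs_apply_le_size z α
  have h1 : ∀ μ, Summable fun z => P μ ν z * (((z + unitVec μ) α : ℤ) : ℝ) := fun μ =>
    hP.summable_mul μ ν 2 fun z => by
      calc |(((z + unitVec μ) α : ℤ) : ℝ)| ≤ size (z + unitVec μ) := abs_apply_le_size _ α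
        _ ≤ 2 * size z := size_add_unitVec_le z μ
        _ = 2 * size z ^ 1 := by rw [pow_one]
  have key := ward_pairing P hT ν (fun z => (z α : ℝ)) h0 h1
  have hdiff : ∀ μ z, (((z + unitVec μ) α : ℤ) : ℝ) - (z α : ℝ) = if μ = α then 1 else 0 := by
    intro μ z
    simp only [Pi.add_apply, unitVec_apply]
    by_cases h : α = μ
    · subst h; simp
    · simp [h, Ne.symm h]
  simp_rw [hdiff, mul_ite, mul_one, mul_zero] at key
  have hite : ∀ μ, (∑' z, if μ = α then P μ ν z else (0 : ℝ)) = if μ = α then ∑' z, P μ ν z else 0 := by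
    intro μ; split_ifs <;> simp
  simp_rw [hite] at key
  simpa using key

/-- [folklore] The same in `HasSum` form (the channel is absolutely summable under `MomentSummable P 1`). -/
theorem hasSum_zero_of_ward_one {P : B12Beta.Kernel d} (hP : MomentSummable P 1) (hT : WardTransversal P) (c e : Fin d) :
    HasSum (P c e) 0 := by
  have hs : Summable (P c e) := by
    have h := hP.summable_mul c e 1 (w := fun _ => (1 : ℝ)) (fun z => by rw [abs_one, one_mul, pow_one]; exact one_le_size z)
    simpa using h
  have h := hs.hasSum
  rwa [tsum_eq_zero_of_ward_one hP hT c e] at h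

end Ward

/-! ## §3 The (K0) socket at sextic decay -/

/-- **THE (K0) LETTER FROM (5.9) + (K6)** [folklore]: `WardTransversal K` and `|K c e t| ≤ C∕(‖t‖∞+1)⁶` give `HasSum (K c e) 0` for every channel — the `hK0` socket of
`HorizontalRemainderPerfect.hbook∕hasym_perfect_of_remainder`, `RemainderLedger.*_of_pieces` and `HorizontalTailAssemblyCov.hasSum_truncatedTransport_cov`. -/
theorem hasSum_zero_of_ward_sextic {K : EKer 4} {C : ℝ} (hK : ∀ c e (t : Pt), |K c e t| ≤ C / ((supNorm t : ℝ) + 1) ^ 6)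
    (hW : WardTransversal K) (c e : Fin 4) : HasSum (K c e) 0 :=
  hasSum_zero_of_ward_one (momentSummable_one_of_sextic hK) hW c e

/-- **THE (K0) LETTER FROM (5.9) IN THE KERNEL CONVENTION + (K6)** [folklore]: `WardTransversal (flipK K)` (RULING (R21): the printed first-index divergence law read on a
`hessKer`-type kernel — the shape of H2-ASM-5a's `PerfectPolarizationWard.wardTransversal_flip_PiBF`) and sextic decay give `HasSum (K c e) 0` for every channel. -/
theorem hasSum_zero_of_ward_flip_sextic {K : EKer 4} {C : ℝ} (hK : ∀ c e (t : Pt), |K c e t| ≤ C / ((supNorm t : ℝ) + 1) ^ 6)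
    (hW : WardTransversal (flipK K)) (c e : Fin 4) : HasSum (K c e) 0 :=
  hasSum_flipK_iff.mp (hasSum_zero_of_ward_one (momentSummable_one_flipK hK) hW c e)

end Summit.QuantumFields.BalabanUV.Beta.FP.WardZerothMomentSextic

end
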